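import Literature.AlgebraicGeometry.Motives.GoodReductionFormalFunctionsProofs
import Literature.AlgebraicGeometry.Morphisms.FormalFunctionsCechProofs
import Mathlib.RingTheory.DedekindDomain.Dvr
import Mathlib.RingTheory.DiscreteValuationRing.Basic
import HarnessLib

/-!
# The special fibre of a smooth proper model, from the finiteness of `H¹(𝒳, 𝒪_𝒳)`

Sibling proofs file of `Literature/AlgebraicGeometry/Motives/GoodReduction.lean`, for the named
fact `Literature.AlgebraicGeometry.Motives.IntegralModel.geometricallyIrreducible_reductionAt`:

> if `X` is a smooth projective geometrically irreducible variety over a number field `K` and `𝒳`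
> is a smooth proper model of `X` over `𝓞_{K,v}`, then the reduction `𝒳 ×_{𝓞_{K,v}} κ(v)` is
> geometrically irreducible

(cited there to the Stacks Project, Tags 0E0N and 056T). This file closes the chain of
conditional discharges built in the sibling files

* `GoodReductionSpecialFibreProofs.lean` (from Stein factorisation / Zariski's connectedness
  theorem, Stacks Project, Tags 03H2, 0AY8),
* `GoodReductionFormalFunctionsProofs.lean` (from the theorem on formal functions for `H⁰`,
  Tag 02OC, indeed from its surjectivity half `HasSurjectiveFormalFunctions 𝔪_v (𝒳 → Spec 𝓞_{K,v})`
  for the one model),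
* `Literature/AlgebraicGeometry/Morphisms/FormalFunctionsCechProofs.lean` (that surjectivity, for
  a flat scheme over a Noetherian ring and a principal ideal `(π)`, from the finiteness of the
  Čech cohomology `Ȟ¹(𝒰, 𝒪_𝒳)` of one finite affine open cover),

down to the weakest printed input, the finiteness of coherent cohomology under proper morphisms
in the single case `H¹(𝒳, 𝒪_𝒳)` (The Stacks Project, Tag 02O5 = Cohomology of Schemes,
Proposition 30.19.1; affine base Tag 02O6 = Lemma 30.19.2), vendored as the named fact
`Literature.AlgebraicGeometry.Morphisms.cechH1_finite` (`Literature/AlgebraicGeometry/Morphisms/CechH1.lean`):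

* `Literature.AlgebraicGeometry.Motives.IntegralModel.geometricallyIrreducible_reductionAt_of_finite_cechH1`:
  the fact for a model `𝒳` follows from `Module.Finite 𝓞_{K,v} (Ȟ¹(𝒰, 𝒪_𝒳))` for ONE finite
  affine open cover `𝒰` of `𝒳` (this is all that is used about coherent cohomology);
* `Literature.AlgebraicGeometry.Motives.IntegralModel.geometricallyIrreducible_reductionAt_of_cechH1_finite
    (h : cechH1_finite) : 𝒳.geometricallyIrreducible_reductionAt` — the named form. Once
  `cechH1_finite_holds` is available,
  `geometricallyIrreducible_reductionAt_holds 𝒳 := 𝒳.geometricallyIrreducible_reductionAt_of_cechH1_finite cechH1_finite_holds`.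

The only new ingredient is that the local ring `𝓞_{K,v} = valuationSubringAtPrime K v` is a
discrete valuation ring (Mathlib `IsLocalization.AtPrime.isDiscreteValuationRing_of_dedekind_domain`),
so that the kernel `𝔪_v` of the reduction map `residueAt v : 𝓞_{K,v} → κ(v)` is the principal
ideal of a uniformiser `π ≠ 0` (`ker_residueAt`, `exists_ker_residueAt_eq_span`), and a smooth
proper model is flat, proper and lives over a Noetherian ring; the rest is
`hasSurjectiveFormalFunctions_of_finite_cechH1` (sibling file) and
`geometricallyIrreducible_reductionAt_of_hasSurjectiveFormalFunctions` (sibling file).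

## The remaining input

What remains for an unconditional `geometricallyIrreducible_reductionAt_holds` is exactly a proof
of `cechH1_finite` — or just of `Module.Finite 𝓞_{K,v} (Ȟ¹(𝒰, 𝒪_𝒳))` for smooth proper `𝒳` over
`𝓞_{K,v}` — i.e. Grothendieck's finiteness theorem for `H¹` of the structure sheaf of a proper
scheme over a Noetherian (here: discrete valuation) ring (EGA III₁ 3.2.1; Stacks Project,
Tag 02O5), whose printed proofs go through Chow's lemma and Serre's computation of the
cohomology of projective space (Tags 088U, 02O3, 01XT); Mathlib has no sheaf cohomology of
schemes, no coherent sheaves and no Čech-to-derived comparison, so this is recorded as the single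
named input (see `NOTES.md` of the literature-prover unit for the dependency graph).

## References

* The Stacks Project, Tag 02O5 (Cohomology of Schemes, Proposition 30.19.1), Tag 02OC
  (Theorem 30.20.5), Tag 03H0 (More on Morphisms, Theorem 37.53.4), Tags 0E0N, 056T.
* A. Grothendieck, EGA III₁, Théorème 3.2.1, Théorème 4.1.5, §4.3.
* R. Hartshorne, *Algebraic Geometry*, III.5.2, III.11.1–III.11.3.
* J.-P. Serre, J. Tate, *Good reduction of abelian varieties*, Ann. of Math. 88 (1968), §1.
-/

noncomputable section

open CategoryTheory AlgebraicGeometry Limits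

universe u

namespace Literature.AlgebraicGeometry.Motives

/-! ### The local ring `𝓞_{K,v}` is a discrete valuation ring -/

section LocalRing

open scoped NumberField

open IsDedekindDomain IsDedekindDomain.HeightOneSpectrum

variable {K : Type} [Field K] [NumberField K] (v : HeightOneSpectrum (𝓞 K))

/-- The local ring `𝓞_{K,v} = valuationSubringAtPrime K v` of a number field at a finite place is
a discrete valuation ring: it is the localisation of the Dedekind domain `𝓞 K` at the nonzero
prime `v` (Mathlib `IsLocalization.AtPrime.isDiscreteValuationRing_of_dedekind_domain`;
Neukirch, *Algebraic Number Theory*, I (11.5)). [folklore] -/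
theorem isDiscreteValuationRing_valuationSubringAtPrime :
    IsDiscreteValuationRing (valuationSubringAtPrime K v) :=
  IsLocalization.AtPrime.isDiscreteValuationRing_of_dedekind_domain (𝓞 K) v.ne_bot _

/-- The kernel of the reduction map `residueAt v : 𝓞_{K,v} → κ(v)` is the maximal ideal `𝔪_v` of
the local ring `𝓞_{K,v}` (`residueAt v` is the residue map followed by the isomorphism
`residueFieldEquiv v`). [folklore] -/
theorem ker_residueAt :
    RingHom.ker (residueAt v) = IsLocalRing.maximalIdeal (valuationSubringAtPrime K v) := by
  have hinj : Function.Injective (residueFieldEquiv v).toRingHom := (residueFieldEquiv v).injective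
  rw [residueAt, RingHom.ker_comp_of_injective _ hinj]
  exact IsLocalRing.ker_residue

/-- The kernel `𝔪_v` of the reduction map `residueAt v : 𝓞_{K,v} → κ(v)` is principal, generated
by a uniformiser `π`, which is a non-zero-divisor of the discrete valuation ring `𝓞_{K,v}`
(Mathlib `IsDiscreteValuationRing.exists_irreducible`, `Irreducible.maximalIdeal_eq`). [folklore] -/
theorem exists_ker_residueAt_eq_span :
    ∃ π : valuationSubringAtPrime K v,
      π ∈ nonZeroDivisors (valuationSubringAtPrime K v) ∧ RingHom.ker (residueAt v) = Ideal.span {π} := by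
  haveI := isDiscreteValuationRing_valuationSubringAtPrime v
  obtain ⟨π, hπ⟩ := IsDiscreteValuationRing.exists_irreducible (valuationSubringAtPrime K v)
  exact ⟨π, mem_nonZeroDivisors_of_ne_zero hπ.ne_zero, (ker_residueAt v).trans hπ.maximalIdeal_eq⟩

end LocalRing

end Literature.AlgebraicGeometry.Motives

/-! ### The special fibre of a smooth proper model -/

namespace Literature.AlgebraicGeometry.Motives.IntegralModel

open scoped NumberField

open IsDedekindDomain IsDedekindDomain.HeightOneSpectrum Morphisms

variable {K : Type} [Field K] [NumberField K] {v : HeightOneSpectrum (𝓞 K)} {X : SchemeOver K}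
  (𝒳 : IntegralModel (valuationSubringAtPrime K v) K X)

/-- **Formal functions for a flat proper model from the finiteness of `Ȟ¹`.** Let
`𝒳 → Spec 𝓞_{K,v}` be an integral model whose structure morphism is flat, and let `𝒰 = (U_i)` be
an affine open cover of `𝒳` with `Ȟ¹(𝒰, 𝒪_𝒳)` a finitely generated `𝓞_{K,v}`-module. Then
`HasSurjectiveFormalFunctions 𝔪_v (𝒳 → Spec 𝓞_{K,v})`: every compatible family of functions on the
infinitesimal neighbourhoods `𝒳 ×_{𝓞_{K,v}} 𝓞_{K,v}/𝔪_v^{n+1}` of the special fibre comes from an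
`𝔪_v`-adic Cauchy sequence of global functions (the surjectivity half of the theorem on formal
functions for `H⁰`, Stacks Project, Tag 02OC, case `p = 0`, `𝓕 = 𝒪_X`, `I = 𝔪_v = (π)`), by
`hasSurjectiveFormalFunctions_of_finite_cechH1` for the uniformiser `π`
(`exists_ker_residueAt_eq_span`). [cite: StacksProject, Tag 02OC (Cohomology of Schemes, Theorem 30.20.5, case p = 0, F = O_X)] -/
theorem hasSurjectiveFormalFunctions_of_finite_cechH1 [Flat 𝒳.total.hom] {ι : Type u}
    (U : ι → 𝒳.total.left.Opens) (hU : ∀ i, IsAffineOpen (U i)) (hcov : ⨆ i, U i = ⊤)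
    (hfin : Module.Finite (valuationSubringAtPrime K v) (CechH1 𝒳.total.hom U)) :
    HasSurjectiveFormalFunctions (RingHom.ker (residueAt v)) 𝒳.total.hom := by
  obtain ⟨π, hπ, hker⟩ := exists_ker_residueAt_eq_span v
  rw [hker]
  exact Morphisms.hasSurjectiveFormalFunctions_of_finite_cechH1 𝒳.total.hom hπ U hU hcov hfin

/-- **Formal functions for a flat proper model from the named fact `cechH1_finite`** (Stacks
Project, Tag 02O5: `H¹(𝒳, 𝒪_𝒳)` is a finite `𝓞_{K,v}`-module for `𝒳` proper over the Noetherian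
ring `𝓞_{K,v}`): `HasSurjectiveFormalFunctions 𝔪_v (𝒳 → Spec 𝓞_{K,v})` for a flat proper model, by
`hasSurjectiveFormalFunctions_of_cechH1_finite` for a uniformiser `π` of `𝓞_{K,v}`.
[cite: StacksProject, Tags 02O5 and 02OC (Cohomology of Schemes, Proposition 30.19.1 and Theorem 30.20.5)] -/
theorem hasSurjectiveFormalFunctions_of_cechH1_finite (h : cechH1_finite.{0})
    [IsProper 𝒳.total.hom] [Flat 𝒳.total.hom] :
    HasSurjectiveFormalFunctions (RingHom.ker (residueAt v)) 𝒳.total.hom := by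
  obtain ⟨π, hπ, hker⟩ := exists_ker_residueAt_eq_span v
  rw [hker]
  exact Morphisms.hasSurjectiveFormalFunctions_of_cechH1_finite 𝒳.total.hom h hπ

/-- **Conditional discharge of `geometricallyIrreducible_reductionAt` for one model from the
finiteness of `Ȟ¹(𝒰, 𝒪_𝒳)` for one affine open cover.** Let `X/K` be smooth projective and
geometrically irreducible, `𝒳 → Spec 𝓞_{K,v}` a smooth proper model, and `𝒰` an affine open
cover of `𝒳` (indexed by a type in `Type`) whose Čech cohomology `Ȟ¹(𝒰, 𝒪_𝒳)` is a finitely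
generated `𝓞_{K,v}`-module (for a finite cover this is the case `i = 1`, `𝓕 = 𝒪_𝒳` of the
finiteness theorem, Stacks Project, Tag 02O5). Then the reduction `𝒳 ×_{𝓞_{K,v}} κ(v)` is
geometrically irreducible: smooth models are flat, so the surjectivity half of the theorem on
formal functions holds for `𝒳` and `𝔪_v` (`hasSurjectiveFormalFunctions_of_finite_cechH1`), and
`geometricallyIrreducible_reductionAt_of_hasSurjectiveFormalFunctions` (Zariski's connectedness
argument of Tag 03H0 plus "smooth and geometrically connected ⇒ geometrically irreducible",
Tag 056T) applies. [cite: StacksProject, Tags 02O5, 02OC, 03H0 and 056T (Cohomology of Schemes, Proposition 30.19.1 and Theorem 30.20.5; More on Morphisms, Theorem 37.53.4; Varieties, Lemma 33.25.4)] -/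
theorem geometricallyIrreducible_reductionAt_of_finite_cechH1 {ι : Type}
    (U : ι → 𝒳.total.left.Opens) (hU : ∀ i, IsAffineOpen (U i)) (hcov : ⨆ i, U i = ⊤)
    (hfin : Module.Finite (valuationSubringAtPrime K v) (CechH1 𝒳.total.hom U)) :
    𝒳.geometricallyIrreducible_reductionAt := by
  intro n hX h
  haveI := h.1
  haveI : Smooth 𝒳.total.hom := SmoothOfRelativeDimension.smooth n _
  exact 𝒳.geometricallyIrreducible_reductionAt_of_hasSurjectiveFormalFunctions
    (𝒳.hasSurjectiveFormalFunctions_of_finite_cechH1 U hU hcov hfin) hX h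

/-- **Conditional discharge of `geometricallyIrreducible_reductionAt` from the named fact
`cechH1_finite`** (The Stacks Project, Tag 02O5 = Cohomology of Schemes, Proposition 30.19.1, case
`i = 1`, `𝓕 = 𝒪_X`, over an affine Noetherian base, with `H¹` computed by the Čech complex of a
finite affine open cover): the reduction `𝒳 ×_{𝓞_{K,v}} κ(v)` of a smooth proper model `𝒳` of a
smooth projective geometrically irreducible `X/K` is geometrically irreducible. The model is flat
(smooth) and proper over the Noetherian ring `𝓞_{K,v}`, so `cechH1_finite` gives the
surjectivity half of the theorem on formal functions for `𝒳` and `𝔪_v = (π)`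
(`hasSurjectiveFormalFunctions_of_cechH1_finite`), and
`geometricallyIrreducible_reductionAt_of_hasSurjectiveFormalFunctions` concludes. This makes
`cechH1_finite` the single named input of the fact: once `cechH1_finite_holds` is available,
`geometricallyIrreducible_reductionAt_holds 𝒳 := 𝒳.geometricallyIrreducible_reductionAt_of_cechH1_finite cechH1_finite_holds`.
[cite: StacksProject, Tags 02O5, 02OC, 03H0 and 056T (Cohomology of Schemes, Proposition 30.19.1 and Theorem 30.20.5; More on Morphisms, Theorem 37.53.4; Varieties, Lemma 33.25.4)] -/
theorem geometricallyIrreducible_reductionAt_of_cechH1_finite (h : cechH1_finite.{0}) :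
    𝒳.geometricallyIrreducible_reductionAt := by
  intro n hX h𝒳
  haveI := h𝒳.1
  haveI := h𝒳.2
  haveI : Smooth 𝒳.total.hom := SmoothOfRelativeDimension.smooth n _
  exact 𝒳.geometricallyIrreducible_reductionAt_of_hasSurjectiveFormalFunctions
    (𝒳.hasSurjectiveFormalFunctions_of_cechH1_finite h) hX h𝒳

end Literature.AlgebraicGeometry.Motives.IntegralModel

end
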